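/-
Copyright (c) 2026 the pub-hodgecm-mathlib formalisation cell (harness21).  Prover seat hodgecm-mathlib-F0P3a-p02 (g18): road «S3-ram» (LEAD F0P3a-plan (g13);
architect A-p16 (g32); junction pen F0P3a-p01 (g17), J-PACK v2 (f) isoceles wave), socket S45-HYPERBOLIC «POOLED REGION DATA of a HYPERBOLIC isoceles literal»
(HYP-PLAN v1 (F0P3a-p04 (g19)) node (V5) ASSEMBLY); 2026-09-02.
-/
import Literature.NumberTheory.Rogawski1990.DepthZeroKappaTransferTypeOneRamifiedHyperbolicLineCounts    -- ★ p848511 (this seat): junction (V2)→(V4); brings ★ V0 V1 V2 LINES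
import Literature.NumberTheory.Rogawski1990.DepthZeroKappaTransferTypeOneRamifiedHyperbolicPool          -- ★ p848342 (this seat): pooling; brings ★ Layers
import Literature.NumberTheory.Rogawski1990.DepthZeroKappaTransferTypeOneRamifiedJunctionTokenSlices  -- ★ (V4) p848299 (F0P3a-p01)
import Literature.NumberTheory.Automorphic.UnitaryLatticeTreeIsocelesAdaptedRegDirCountRamified        -- ★ (V3′) p848545∕ED. 2 (this seat); brings ★ (V3)(i) LH4-p02
import Literature.NumberTheory.Automorphic.UnitaryLatticeTreeIsocelesRegionEndRamified                 -- ★ (J-END) p848515 (A-p16)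
import Literature.NumberTheory.Automorphic.UnitaryLatticeTreeIsocelesRegionLayersRamified              -- ★ (V3)(iv) p848569 (F0P3-p03 (g16)): `isoceles_regionCard_of_dirCounts`; brings ★ BRANCHING p848338
import Literature.NumberTheory.Automorphic.UnitaryLatticeTreeFramesOfInvolution                        -- ★ `isTree_latticeGraph_three_of_neg`
import HarnessLib

/-!
# The ramified type-(1) `κ`-orbital integral: THE POOLED REGION DATA OF A HYPERBOLIC ISOCELES LITERAL at a tamely ramified place — socket `row_S45_hyperbolic`
# (Rogawski 1990 §4.9; Kottwitz 1986 §3; Bruhat–Tits 1972 §10)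

Topic `NumberTheory/Rogawski1990`; namespace `Literature.NumberTheory.Rogawski1990`.  THEOREMS ONLY (no definition, no instance, no notation, no named fact, no `sorry`);
kernel lane `--supports stmt-HodgeConjecture-24833`.  Cell `pub/hodgecm-mathlib` (D-0151), crux H413; road «S3-ram» (count-neutral); junction J-PACK v2 (F0P3a-p01 (g17)),
iso engine `strataCount_J₀_isoceles` (★ p848026), socket **S45-HYPERBOLIC** = `row_S45_hyperbolic` of the hand's cut `F0/P3a/F0P3a-p02/g17/iso/JunctionSocketsS45.statementfirst.v4.F0P3ap02g17.lean`
:46 (bc98a4a1; binders 0–41 = the engine's VERBATIM, then `(s' hs' hgap) {j k} (hj hk hjk) (hhyp)`) = the `hHyp` hypothesis of ★ (J★) `signedStrataCount_typeOne_ram_isoceles_of_strataCount`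
(A-p16, p848413) and of ★ (β) `signedStrataCount_typeOne_ram_of_hyperbolic` (F0P3a-p01, p848526), VERBATIM.

THE MATHEMATICS.  An isoceles literal `γ = A·diag(s)·A⁻¹` (isolated index `i₀` at depth `d₀ = 2mA + 3`, close pair `j, k` with gap EXACTLY `d₀ + 2s'`, `s' ≥ 1`) whose
root plane is residually HYPERBOLIC (`hhyp`: `−d_j∕d_k` a norm residue).  The root region `R = {γv = v, v self-dual, LEV[v](ϖ^{d₀})}` is a rooted tree of region vertices with
`2q` region grandchildren at the root, `q` at every interior vertex and none at the END vertices (distance `2s'`), so `#R = 1 + 2q(1 + ⋯ + q^{s'−1})` with `2q^{s'}` END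
vertices ((V3) F0P3-p03 ∕ LH4-p02).  At every region vertex `v = u·r₀` with ADAPTED frame `u` (★ (V0) F0P3a-p04; at the root via a region-direction child, which exists by
`hhyp`), the off-region grandchildren carry the engine tokens E ∕ P ∕ M according to the κ-keyed LINE data of `v` (★ (V4) F0P3a-p01 ∘ ★ junction p848511 ∘ ★ (V2) LH4-p02 ∘
★ (V1) F0P3a-p04 ∘ ★ (V3′)): per NON-END vertex `(0, q(q−1)[lock], q(q−1)[¬lock])`, per END vertex `(2q[BIG], …)` with `2P, 2M ∈ q·{q−3, q−1, q+1}` by the four sign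
cases — `lock` = the class of the root-line value `C`, `BIG` = the square class of the END constant `B` (S45 texts).  ★ POOLING p848342 adds them up: the four conjuncts.
HONEST LABEL: HC_CM is proved only modulo the 2 remaining named inputs (hLiu418 24832, h413 24833) until rung 0 closes; nothing printed is asserted here (lattice
bookkeeping over ★ results); «S3-ram» is Literature seeding, count-neutral.

## References
* [Rogawski1990] J. D. Rogawski, *Automorphic Representations of Unitary Groups in Three Variables*, Ann. of Math. Stud. 123 (1990), §4.9 Prop. 4.9.1 pp. 54–56.
* [Kottwitz1986] R. E. Kottwitz, *Base change for unit elements of Hecke algebras*, Compositio Math. 60 (1986), §3.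
* [BruhatTits1972] F. Bruhat, J. Tits, *Groupes réductifs sur un corps local I*, Publ. Math. IHÉS 41 (1972), §10.
* [Serre1980Trees] J.-P. Serre, *Trees* (1980), I.2.3, II.1.1.
-/

set_option autoImplicit false

noncomputable section

open scoped Valued WithZero Matrix MatrixGroups
open Polynomial Classical SimpleGraph
open Literature.NumberTheory.Automorphic Literature.NumberTheory.Automorphic.HermitianLattice Literature.NumberTheory.Automorphic.UnitaryLatticeTree
open Literature.Combinatorics.SimpleGraph.TreeLayers

namespace Literature.NumberTheory.Rogawski1990

variable {K : Type*} [Field K] [Valued K ℤᵐ⁰] {σ : K →+* K} {ϖ : K}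

set_option maxHeartbeats 800000 in
/-- **S45-HYPERBOLIC «POOLED REGION DATA, hyperbolic root plane»** (socket∕supplier of the iso engine's `sR.card`, `hPE`, `hPP`, `hPM`): `#R = 1 + 2qΣ_{i<s'}qⁱ`,
`ΣE = q·4q^{s'}[BIG]`, `ΣP`, `ΣM` = `q·((q−1)N + q^{s'}(q−2∓1))` ∕ `q·q^{s'}(q∓1)` according to `lock`, `N = 1 + 2qΣ_{i<s'−1}qⁱ` — the text of S45 v4 :46 VERBATIM
(★ V0 ∘ ★ V1 ∘ ★ V2 ∘ ★ V3 ∘ ★ V3′ ∘ ★ V4 ∘ ★ junction ∘ ★ J-END ∘ ★ pool). [cite: Rogawski1990, §4.9 Prop. 4.9.1 p. 55] [cite: Kottwitz1986, §3] [cite: BruhatTits1972, §10] -/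
theorem isoceles_hyperbolic_regionCard_and_tokenCounts [ValuativeRel K] [(Valued.v : Valuation K ℤᵐ⁰).Compatible]
    (hσ : ∀ x, σ (σ x) = x) (hvσ : ∀ a, Valued.v (σ a) = Valued.v a) (hσϖ : σ ϖ = -ϖ)
    (hϖ : Valued.v ϖ = WithZero.exp (-1 : ℤ)) (hres : ∀ x : K, Valued.v x ≤ 1 → Valued.v (σ x - x) < 1) (h2 : Valued.v (2 : K) = 1)
    (hnorm : ∀ u : K, σ u = u → Valued.v (u - 1) < 1 → ∃ z : K, z * σ z = u ∧ Valued.v (z - 1) ≤ Valued.v (u - 1)) [Fintype 𝓀[K]] [DecidableEq 𝓀[K]]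
    {γ : unitaryGroupOfForm σ ((StdForm.antidiagonal 3).over K)} (hγ0 : γ ∈ unitaryInt σ ((StdForm.antidiagonal 3).over K))
    (d : Fin 3 → K) (hd : ∀ i, Valued.v (d i) = 1) (hdσ : ∀ i, σ (d i) = d i)
    (A : GL (Fin 3) K) (hA : IsIntMatrix (A : Matrix (Fin 3) (Fin 3) K)) (hA' : IsIntMatrix ((A⁻¹ : GL (Fin 3) K) : Matrix (Fin 3) (Fin 3) K))
    (hdA : Matrix.diagonal d = (-(Matrix.diagonal d).det) • formCongr σ A ((StdForm.antidiagonal 3).over K))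
    (s : Fin 3 → K) (hs1 : s 1 = 1) (hsv : ∀ i, Valued.v (s i) = 1) (hsσ : ∀ i, s i * σ (s i) = 1)
    (hγA : ((γ : GL (Fin 3) K) : Matrix (Fin 3) (Fin 3) K) = (A : Matrix (Fin 3) (Fin 3) K) * Matrix.diagonal s * ((A⁻¹ : GL (Fin 3) K) : Matrix (Fin 3) (Fin 3) K))
    (i₀ : Fin 3) {d₀ : ℕ} (hd3 : 3 ≤ d₀) (he : ∀ i, Valued.v (s i - 1) ≤ Valued.v ϖ ^ d₀)
    (hiso : ∀ j, j ≠ i₀ → Valued.v (s i₀ - s j) = Valued.v ϖ ^ d₀) (hclose : ∀ j k, j ≠ i₀ → k ≠ i₀ → Valued.v (s j - s k) ≤ Valued.v ϖ ^ (d₀ + 2))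
    (hreg : ∀ i j, i ≠ j → s i ≠ s j)
    (mA : ℕ) (_hmA : d₀ = 2 * mA + 3)
    (c₁ ε : K) (hc₁ : Valued.v c₁ = 1) (hεv : Valued.v ε = 1) (hε : ∀ z : K, Valued.v z ≤ 1 → Valued.v (z ^ 2 - ε) = 1)
    (q : ℕ) (hq : q = Fintype.card 𝓀[K])
    (sR : Finset {M : Submodule 𝒪[K] (Fin 3 → K) // IsVertex σ ϖ ((StdForm.antidiagonal 3).over K) M}) (hsR : ∀ v, v ∈ sR ↔ v ∈ {v : {M : Submodule 𝒪[K] (Fin 3 → K) // IsVertex σ ϖ ((StdForm.antidiagonal 3).over K) M} | latticeGraphIso σ ϖ ((StdForm.antidiagonal 3).over K) γ v = v ∧ IsSelfDualLattice σ ϖ ((StdForm.antidiagonal 3).over K) v.1 ∧ v.1.map ((Matrix.toLin' (((γ : GL (Fin 3) K) : Matrix (Fin 3) (Fin 3) K) - 1)).restrictScalars 𝒪[K]) ≤ scaleLattice (ϖ ^ d₀) v.1})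
    (s' : ℕ) (hs' : 1 ≤ s') (hgap : ∀ j k, j ≠ i₀ → k ≠ i₀ → j ≠ k → Valued.v (s j - s k) = Valued.v ϖ ^ (d₀ + 2 * s'))
    {j k : Fin 3} (hj : j ≠ i₀) (hk : k ≠ i₀) (hjk : j ≠ k)
    (hhyp : ∃ t : K, Valued.v t = 1 ∧ Valued.v (d j + t * σ t * d k) < 1) :
    sR.card = 1 + 2 * q * ∑ i ∈ Finset.range s', q ^ i ∧
    ∑ v ∈ sR, ({w | w ∈ {w | ∃ c, ((latticeGraph σ ϖ ((StdForm.antidiagonal 3).over K)).Adj v c ∧ (latticeGraph σ ϖ ((StdForm.antidiagonal 3).over K)).dist ⟨stdLattice K 3, 0, isSelfDualLattice_stdLattice_three_of_v hϖ⟩ c = (latticeGraph σ ϖ ((StdForm.antidiagonal 3).over K)).dist ⟨stdLattice K 3, 0, isSelfDualLattice_stdLattice_three_of_v hϖ⟩ v + 1 ∧ latticeGraphIso σ ϖ ((StdForm.antidiagonal 3).over K) γ c = c) ∧ ((latticeGraph σ ϖ ((StdForm.antidiagonal 3).over K)).Adj c w ∧ (latticeGraph σ ϖ ((StdForm.antidiagonal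 3).over K)).dist ⟨stdLattice K 3, 0, isSelfDualLattice_stdLattice_three_of_v hϖ⟩ w = (latticeGraph σ ϖ ((StdForm.antidiagonal 3).over K)).dist ⟨stdLattice K 3, 0, isSelfDualLattice_stdLattice_three_of_v hϖ⟩ c + 1 ∧ latticeGraphIso σ ϖ ((StdForm.antidiagonal 3).over K) γ w = w)} ∧ (¬ w.1.map ((Matrix.toLin' (((γ : GL (Fin 3) K) : Matrix (Fin 3) (Fin 3) K) - 1)).restrictScalars 𝒪[K]) ≤ scaleLattice (ϖ ^ d₀) w.1 ∧ (w.1.map ((Matrix.toLin' (((γ : GL (Fin 3) K) : Matrix (Fin 3) (Fin 3) K) - 1)).restrictScalars 𝒪[K]) ≤ scaleLattice (ϖ ^ (d₀ - 1)) w.1 ∧ ¬ w.1.map ((Matrix.toLin' (((γ : GL (Fin 3) K) : Matrix (Fin 3) (Fin 3) K) - 1)).restrictScalars 𝒪[K]) ≤ scaleLattice (ϖ ^ d₀) w.1))}).ncard = q * (if (∃ t : K, Valued.v t = 1 ∧ Valued.v (t ^ 2 - ((-1) ^ (s' + 1) * ((ϖ ^ d₀)⁻¹ * (s i₀ - s j))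 * ((ϖ ^ (d₀ + 2 * s'))⁻¹ * (s k - s j)) * (d i₀ * d k))) < 1) then 4 * q ^ s' else 0) ∧
    ∑ v ∈ sR, ({w | w ∈ {w | ∃ c, ((latticeGraph σ ϖ ((StdForm.antidiagonal 3).over K)).Adj v c ∧ (latticeGraph σ ϖ ((StdForm.antidiagonal 3).over K)).dist ⟨stdLattice K 3, 0, isSelfDualLattice_stdLattice_three_of_v hϖ⟩ c = (latticeGraph σ ϖ ((StdForm.antidiagonal 3).over K)).dist ⟨stdLattice K 3, 0, isSelfDualLattice_stdLattice_three_of_v hϖ⟩ v + 1 ∧ latticeGraphIso σ ϖ ((StdForm.antidiagonal 3).over K) γ c = c) ∧ ((latticeGraph σ ϖ ((StdForm.antidiagonal 3).over K)).Adj c w ∧ (latticeGraph σ ϖ ((StdForm.antidiagonal 3).over K)).dist ⟨stdLattice K 3, 0, isSelfDualLattice_stdLattice_three_of_v hϖ⟩ w = (latticeGraph σ ϖ ((StdForm.antidiagonal 3).over K)).dist ⟨stdLattice K 3, 0, isSelfDualLattice_stdLattice_three_of_v hϖ⟩ c + 1 ∧ latticeGraphIso σ ϖ ((StdForm.antidiagonal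 3).over K) γ w = w)} ∧ (¬ w.1.map ((Matrix.toLin' (((γ : GL (Fin 3) K) : Matrix (Fin 3) (Fin 3) K) - 1)).restrictScalars 𝒪[K]) ≤ scaleLattice (ϖ ^ d₀) w.1 ∧ (w.1.map ((Matrix.toLin' (((γ : GL (Fin 3) K) : Matrix (Fin 3) (Fin 3) K) - 1)).restrictScalars 𝒪[K]) ≤ scaleLattice (ϖ ^ (d₀ - 2)) w.1 ∧ ¬ w.1.map ((Matrix.toLin' (((γ : GL (Fin 3) K) : Matrix (Fin 3) (Fin 3) K) - 1)).restrictScalars 𝒪[K]) ≤ scaleLattice (ϖ ^ (d₀ - 1)) w.1) ∧ ∃ y ∈ w.1, ∃ a : K, Valued.v a = 1 ∧ Valued.v ((ϖ ^ (d₀ - 2))⁻¹ * pairing σ ((StdForm.antidiagonal 3).over K) y ((((γ : GL (Fin 3) K) : Matrix (Fin 3) (Fin 3) K) - 1) *ᵥ y) - (c₁) * a ^ 2) < 1)}).ncard = q * (if (∃ a : K, Valued.v a = 1 ∧ Valued.v (((ϖ ^ d₀)⁻¹ * (s i₀ - s j) * (d i₀ * (-(Matrix.diagonal d).det)⁻¹))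 + c₁ * a ^ 2) < 1) then (if (∃ t : K, Valued.v t = 1 ∧ Valued.v (t ^ 2 - ((-1) ^ (s' + 1) * ((ϖ ^ d₀)⁻¹ * (s i₀ - s j)) * ((ϖ ^ (d₀ + 2 * s'))⁻¹ * (s k - s j)) * (d i₀ * d k))) < 1) then (q - 1) * (1 + 2 * q * ∑ i ∈ Finset.range (s' - 1), q ^ i) + q ^ s' * (q - 3) else (q - 1) * (1 + 2 * q * ∑ i ∈ Finset.range (s' - 1), q ^ i) + q ^ s' * (q - 1)) else (if (∃ t : K, Valued.v t = 1 ∧ Valued.v (t ^ 2 - ((-1) ^ (s' + 1) * ((ϖ ^ d₀)⁻¹ * (s i₀ - s j)) * ((ϖ ^ (d₀ + 2 * s'))⁻¹ * (s k - s j)) * (d i₀ * d k))) < 1) then q ^ s' * (q - 1) else q ^ s' * (q + 1))) ∧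
    ∑ v ∈ sR, ({w | w ∈ {w | ∃ c, ((latticeGraph σ ϖ ((StdForm.antidiagonal 3).over K)).Adj v c ∧ (latticeGraph σ ϖ ((StdForm.antidiagonal 3).over K)).dist ⟨stdLattice K 3, 0, isSelfDualLattice_stdLattice_three_of_v hϖ⟩ c = (latticeGraph σ ϖ ((StdForm.antidiagonal 3).over K)).dist ⟨stdLattice K 3, 0, isSelfDualLattice_stdLattice_three_of_v hϖ⟩ v + 1 ∧ latticeGraphIso σ ϖ ((StdForm.antidiagonal 3).over K) γ c = c) ∧ ((latticeGraph σ ϖ ((StdForm.antidiagonal 3).over K)).Adj c w ∧ (latticeGraph σ ϖ ((StdForm.antidiagonal 3).over K)).dist ⟨stdLattice K 3, 0, isSelfDualLattice_stdLattice_three_of_v hϖ⟩ w = (latticeGraph σ ϖ ((StdForm.antidiagonal 3).over K)).dist ⟨stdLattice K 3, 0, isSelfDualLattice_stdLattice_three_of_v hϖ⟩ c + 1 ∧ latticeGraphIso σ ϖ ((StdForm.antidiagonal 3).over K) γ w = w)} ∧ (¬ w.1.map ((Matrix.toLin' (((γ : GL (Fin 3) K) : Matrix (Fin 3) (Fin 3)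 K) - 1)).restrictScalars 𝒪[K]) ≤ scaleLattice (ϖ ^ d₀) w.1 ∧ (w.1.map ((Matrix.toLin' (((γ : GL (Fin 3) K) : Matrix (Fin 3) (Fin 3) K) - 1)).restrictScalars 𝒪[K]) ≤ scaleLattice (ϖ ^ (d₀ - 2)) w.1 ∧ ¬ w.1.map ((Matrix.toLin' (((γ : GL (Fin 3) K) : Matrix (Fin 3) (Fin 3) K) - 1)).restrictScalars 𝒪[K]) ≤ scaleLattice (ϖ ^ (d₀ - 1)) w.1) ∧ ¬ (∃ y ∈ w.1, ∃ a : K, Valued.v a = 1 ∧ Valued.v ((ϖ ^ (d₀ - 2))⁻¹ * pairing σ ((StdForm.antidiagonal 3).over K) y ((((γ : GL (Fin 3) K) : Matrix (Fin 3) (Fin 3) K) - 1) *ᵥ y) - (c₁) * a ^ 2) < 1))}).ncard = q * (if (∃ a : K, Valued.v a = 1 ∧ Valued.v (((ϖ ^ d₀)⁻¹ * (s i₀ - s j) * (d i₀ * (-(Matrix.diagonal d).det)⁻¹)) + c₁ * a ^ 2) < 1) then (if (∃ t : K, Valued.v t = 1 ∧ Valued.v (t ^ 2 - ((-1) ^ (s'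 + 1) * ((ϖ ^ d₀)⁻¹ * (s i₀ - s j)) * ((ϖ ^ (d₀ + 2 * s'))⁻¹ * (s k - s j)) * (d i₀ * d k))) < 1) then q ^ s' * (q - 1) else q ^ s' * (q + 1)) else (if (∃ t : K, Valued.v t = 1 ∧ Valued.v (t ^ 2 - ((-1) ^ (s' + 1) * ((ϖ ^ d₀)⁻¹ * (s i₀ - s j)) * ((ϖ ^ (d₀ + 2 * s'))⁻¹ * (s k - s j)) * (d i₀ * d k))) < 1) then (q - 1) * (1 + 2 * q * ∑ i ∈ Finset.range (s' - 1), q ^ i) + q ^ s' * (q - 3) else (q - 1) * (1 + 2 * q * ∑ i ∈ Finset.range (s' - 1), q ^ i) + q ^ s' * (q - 1))) := by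
  have hϖ0 : ϖ ≠ 0 := fun h0 => by rw [h0, map_zero] at hϖ; exact WithZero.coe_ne_zero hϖ.symm
  have hqk : Nat.card 𝓀[K] = q := by rw [hq, Nat.card_eq_fintype_card]
  have hk2 : ringChar 𝓀[K] ≠ 2 := ringChar_residueField_ne_two h2
  have hq3 : 3 ≤ q := by
    rw [hq]
    have hm1 : (-1 : 𝓀[K]) ≠ 1 := Ring.neg_one_ne_one_of_char_ne_two hk2
    exact Fintype.two_lt_card_iff.2 ⟨0, 1, -1, zero_ne_one, (neg_ne_zero.2 one_ne_zero).symm, hm1.symm⟩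
  have hT := isTree_latticeGraph_three_of_neg hσ hvσ hϖ hσϖ hres h2 hnorm
  -- ### per-vertex data: region token, J-END dichotomy, adapted frame, set identities
  have hmem : ∀ v ∈ sR, latticeGraphIso σ ϖ ((StdForm.antidiagonal 3).over K) γ v = v ∧ IsSelfDualLattice σ ϖ ((StdForm.antidiagonal 3).over K) v.1 ∧ v.1.map ((Matrix.toLin' (((γ : GL (Fin 3) K) : Matrix (Fin 3) (Fin 3) K) - 1)).restrictScalars 𝒪[K]) ≤ scaleLattice (ϖ ^ d₀) v.1 := fun v hv => (hsR v).1 hv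
  have hjend : ∀ v ∈ sR, ((latticeGraph σ ϖ ((StdForm.antidiagonal 3).over K)).dist ⟨stdLattice K 3, 0, isSelfDualLattice_stdLattice_three_of_v hϖ⟩ v = 2 * s' ↔ ¬ ϖ ^ (s' - 1) • ((A : Matrix (Fin 3) (Fin 3) K) *ᵥ Pi.single k 1) ∈ v.1) := fun v hv =>
    dist_root_eq_two_mul_iff_not_pow_smul_mem_of_neg hσ hvσ hσϖ hϖ hres h2 hnorm A hA hA' hd hdA s hγA i₀ he hiso hgap hs' (hmem v hv).2.1 (hmem v hv).2.2 hk
  have hframe : ∀ v ∈ sR, ϖ ^ (s' - 1) • ((A : Matrix (Fin 3) (Fin 3) K) *ᵥ Pi.single k 1) ∈ v.1 → ∃ u : unitaryGroupOfForm σ ((StdForm.antidiagonal 3).over K), v = latticeGraphIso σ ϖ ((StdForm.antidiagonal 3).over K) u ⟨stdLattice K 3, 0, isSelfDualLattice_stdLattice_three_of_v hϖ⟩ ∧ Valued.v (pairing σ ((StdForm.antidiagonal 3).over K) ((A : Matrix (Fin 3) (Fin 3) K) *ᵥ Pi.single i₀ 1) (((u : GL (Fin 3) K) : Matrix (Fin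 3) (Fin 3) K) *ᵥ Pi.single 0 1)) < 1 ∧ Valued.v (pairing σ ((StdForm.antidiagonal 3).over K) (ϖ ^ s' • ((A : Matrix (Fin 3) (Fin 3) K) *ᵥ Pi.single k 1)) (((u : GL (Fin 3) K) : Matrix (Fin 3) (Fin 3) K) *ᵥ Pi.single 0 1)) < 1 ∧
      ({c : {M : Submodule 𝒪[K] (Fin 3 → K) // IsVertex σ ϖ ((StdForm.antidiagonal 3).over K) M} | (latticeGraph σ ϖ ((StdForm.antidiagonal 3).over K)).Adj v c ∧ (latticeGraph σ ϖ ((StdForm.antidiagonal 3).over K)).dist ⟨stdLattice K 3, 0, isSelfDualLattice_stdLattice_three_of_v hϖ⟩ c = (latticeGraph σ ϖ ((StdForm.antidiagonal 3).over K)).dist ⟨stdLattice K 3, 0, isSelfDualLattice_stdLattice_three_of_v hϖ⟩ v + 1 ∧ ∃ κ : unitaryGroupOfForm σ ((StdForm.antidiagonal 3).over K), κ ∈ unitaryInt σ ((StdForm.antidiagonal 3).over K) ∧ c = latticeGraphIso σ ϖ ((StdForm.antidiagonal 3).over K) (u * κ) ⟨latt (Matrix.diagonal ![(1 : K), 1,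 ϖ]), 2, isVertexLattice_two_N₁_of_neg hσϖ hϖ⟩ ∧ (¬ (Valued.v (pairing σ ((StdForm.antidiagonal 3).over K) ((((u * κ : unitaryGroupOfForm σ ((StdForm.antidiagonal 3).over K)) : GL (Fin 3) K) : Matrix (Fin 3) (Fin 3) K) *ᵥ Pi.single 0 1) ((A : Matrix (Fin 3) (Fin 3) K) *ᵥ Pi.single i₀ 1)) < 1 ∧ Valued.v (pairing σ ((StdForm.antidiagonal 3).over K) ((((u * κ : unitaryGroupOfForm σ ((StdForm.antidiagonal 3).over K)) : GL (Fin 3) K) : Matrix (Fin 3) (Fin 3) K) *ᵥ Pi.single 0 1) (ϖ ^ s' • ((A : Matrix (Fin 3) (Fin 3) K) *ᵥ Pi.single k 1))) < 1) ∧ Valued.v ((ϖ ^ d₀)⁻¹ * pairing σ ((StdForm.antidiagonal 3).over K) (((κ : GL (Fin 3) K) : Matrix (Fin 3) (Fin 3) K) *ᵥ Pi.single 0 1) (((((u⁻¹ * γ * u : unitaryGroupOfForm σ ((StdForm.antidiagonal 3).over K)) : GL (Fin 3) K) : Matrix (Fin 3) (Fin 3) K) - 1) *ᵥ (((κ : GL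 (Fin 3) K) : Matrix (Fin 3) (Fin 3) K) *ᵥ Pi.single 0 1))) < 1)} = {c : {M : Submodule 𝒪[K] (Fin 3 → K) // IsVertex σ ϖ ((StdForm.antidiagonal 3).over K) M} | (latticeGraph σ ϖ ((StdForm.antidiagonal 3).over K)).Adj v c ∧ ∃ κ : unitaryGroupOfForm σ ((StdForm.antidiagonal 3).over K), κ ∈ unitaryInt σ ((StdForm.antidiagonal 3).over K) ∧ c = latticeGraphIso σ ϖ ((StdForm.antidiagonal 3).over K) (u * κ) ⟨latt (Matrix.diagonal ![(1 : K), 1, ϖ]), 2, isVertexLattice_two_N₁_of_neg hσϖ hϖ⟩ ∧ Valued.v ((ϖ ^ d₀)⁻¹ * pairing σ ((StdForm.antidiagonal 3).over K) (((κ : GL (Fin 3) K) : Matrix (Fin 3) (Fin 3) K) *ᵥ Pi.single 0 1) (((((u⁻¹ * γ * u : unitaryGroupOfForm σ ((StdForm.antidiagonal 3).over K)) : GL (Fin 3) K) : Matrix (Fin 3) (Fin 3) K) - 1) *ᵥ (((κ : GL (Fin 3) K) : Matrix (Fin 3) (Fin 3) K) *ᵥ Pi.single 0 1))) < 1} \ {c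 : {M : Submodule 𝒪[K] (Fin 3 → K) // IsVertex σ ϖ ((StdForm.antidiagonal 3).over K) M} | (latticeGraph σ ϖ ((StdForm.antidiagonal 3).over K)).Adj v c ∧ ∃ κ : unitaryGroupOfForm σ ((StdForm.antidiagonal 3).over K), κ ∈ unitaryInt σ ((StdForm.antidiagonal 3).over K) ∧ c = latticeGraphIso σ ϖ ((StdForm.antidiagonal 3).over K) (u * κ) ⟨latt (Matrix.diagonal ![(1 : K), 1, ϖ]), 2, isVertexLattice_two_N₁_of_neg hσϖ hϖ⟩ ∧ (Valued.v (pairing σ ((StdForm.antidiagonal 3).over K) ((((u * κ : unitaryGroupOfForm σ ((StdForm.antidiagonal 3).over K)) : GL (Fin 3) K) : Matrix (Fin 3) (Fin 3) K) *ᵥ Pi.single 0 1) ((A : Matrix (Fin 3) (Fin 3) K) *ᵥ Pi.single i₀ 1)) < 1 ∧ Valued.v (pairing σ ((StdForm.antidiagonal 3).over K) ((((u * κ : unitaryGroupOfForm σ ((StdForm.antidiagonal 3).over K)) : GL (Fin 3) K) : Matrix (Fin 3) (Fin 3) K) *ᵥ Pi.single 0 1) (ϖ ^ s' • ((A : Matrix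 (Fin 3) (Fin 3) K) *ᵥ Pi.single k 1))) < 1)} ∧
        {c : {M : Submodule 𝒪[K] (Fin 3 → K) // IsVertex σ ϖ ((StdForm.antidiagonal 3).over K) M} | (latticeGraph σ ϖ ((StdForm.antidiagonal 3).over K)).Adj v c ∧ ∃ κ : unitaryGroupOfForm σ ((StdForm.antidiagonal 3).over K), κ ∈ unitaryInt σ ((StdForm.antidiagonal 3).over K) ∧ c = latticeGraphIso σ ϖ ((StdForm.antidiagonal 3).over K) (u * κ) ⟨latt (Matrix.diagonal ![(1 : K), 1, ϖ]), 2, isVertexLattice_two_N₁_of_neg hσϖ hϖ⟩ ∧ (Valued.v (pairing σ ((StdForm.antidiagonal 3).over K) ((((u * κ : unitaryGroupOfForm σ ((StdForm.antidiagonal 3).over K)) : GL (Fin 3) K) : Matrix (Fin 3) (Fin 3) K) *ᵥ Pi.single 0 1) ((A : Matrix (Fin 3) (Fin 3) K) *ᵥ Pi.single i₀ 1)) < 1 ∧ Valued.v (pairing σ ((StdForm.antidiagonal 3).over K) ((((u * κ : unitaryGroupOfForm σ ((StdForm.antidiagonal 3).over K)) : GL (Fin 3) K) : Matrix (Fin 3)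 (Fin 3) K) *ᵥ Pi.single 0 1) (ϖ ^ s' • ((A : Matrix (Fin 3) (Fin 3) K) *ᵥ Pi.single k 1))) < 1)} ⊆ {c : {M : Submodule 𝒪[K] (Fin 3 → K) // IsVertex σ ϖ ((StdForm.antidiagonal 3).over K) M} | (latticeGraph σ ϖ ((StdForm.antidiagonal 3).over K)).Adj v c ∧ ∃ κ : unitaryGroupOfForm σ ((StdForm.antidiagonal 3).over K), κ ∈ unitaryInt σ ((StdForm.antidiagonal 3).over K) ∧ c = latticeGraphIso σ ϖ ((StdForm.antidiagonal 3).over K) (u * κ) ⟨latt (Matrix.diagonal ![(1 : K), 1, ϖ]), 2, isVertexLattice_two_N₁_of_neg hσϖ hϖ⟩ ∧ Valued.v ((ϖ ^ d₀)⁻¹ * pairing σ ((StdForm.antidiagonal 3).over K) (((κ : GL (Fin 3) K) : Matrix (Fin 3) (Fin 3) K) *ᵥ Pi.single 0 1) (((((u⁻¹ * γ * u : unitaryGroupOfForm σ ((StdForm.antidiagonal 3).over K)) : GL (Fin 3) K) : Matrix (Fin 3) (Fin 3) K) - 1) *ᵥ (((κ : GL (Fin 3) K) : Matrix (Fin 3)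 (Fin 3) K) *ᵥ Pi.single 0 1))) < 1} ∧
        {c : {M : Submodule 𝒪[K] (Fin 3 → K) // IsVertex σ ϖ ((StdForm.antidiagonal 3).over K) M} | (latticeGraph σ ϖ ((StdForm.antidiagonal 3).over K)).Adj v c ∧ (latticeGraph σ ϖ ((StdForm.antidiagonal 3).over K)).dist ⟨stdLattice K 3, 0, isSelfDualLattice_stdLattice_three_of_v hϖ⟩ c = (latticeGraph σ ϖ ((StdForm.antidiagonal 3).over K)).dist ⟨stdLattice K 3, 0, isSelfDualLattice_stdLattice_three_of_v hϖ⟩ v + 1 ∧ ∃ κ : unitaryGroupOfForm σ ((StdForm.antidiagonal 3).over K), κ ∈ unitaryInt σ ((StdForm.antidiagonal 3).over K) ∧ c = latticeGraphIso σ ϖ ((StdForm.antidiagonal 3).over K) (u * κ) ⟨latt (Matrix.diagonal ![(1 : K), 1, ϖ]), 2, isVertexLattice_two_N₁_of_neg hσϖ hϖ⟩ ∧ (¬ (Valued.v (pairing σ ((StdForm.antidiagonal 3).over K) ((((u * κ : unitaryGroupOfForm σ ((StdForm.antidiagonal 3).over K)) : GL (Fin 3) K) : Matrix (Fin 3) (Fin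 3) K) *ᵥ Pi.single 0 1) ((A : Matrix (Fin 3) (Fin 3) K) *ᵥ Pi.single i₀ 1)) < 1 ∧ Valued.v (pairing σ ((StdForm.antidiagonal 3).over K) ((((u * κ : unitaryGroupOfForm σ ((StdForm.antidiagonal 3).over K)) : GL (Fin 3) K) : Matrix (Fin 3) (Fin 3) K) *ᵥ Pi.single 0 1) (ϖ ^ s' • ((A : Matrix (Fin 3) (Fin 3) K) *ᵥ Pi.single k 1))) < 1) ∧ ∃ a : K, Valued.v a = 1 ∧ Valued.v (((ϖ ^ d₀)⁻¹ * pairing σ ((StdForm.antidiagonal 3).over K) (((κ : GL (Fin 3) K) : Matrix (Fin 3) (Fin 3) K) *ᵥ Pi.single 0 1) (((((u⁻¹ * γ * u : unitaryGroupOfForm σ ((StdForm.antidiagonal 3).over K)) : GL (Fin 3) K) : Matrix (Fin 3) (Fin 3) K) - 1) *ᵥ (((κ : GL (Fin 3) K) : Matrix (Fin 3) (Fin 3) K) *ᵥ Pi.single 0 1))) - (-c₁) * a ^ 2) < 1)} = {c : {M : Submodule 𝒪[K] (Fin 3 → K) // IsVertex σ ϖ ((StdForm.antidiagonal 3).over K)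 M} | (latticeGraph σ ϖ ((StdForm.antidiagonal 3).over K)).Adj v c ∧ ∃ κ : unitaryGroupOfForm σ ((StdForm.antidiagonal 3).over K), κ ∈ unitaryInt σ ((StdForm.antidiagonal 3).over K) ∧ c = latticeGraphIso σ ϖ ((StdForm.antidiagonal 3).over K) (u * κ) ⟨latt (Matrix.diagonal ![(1 : K), 1, ϖ]), 2, isVertexLattice_two_N₁_of_neg hσϖ hϖ⟩ ∧ (∃ a : K, Valued.v a = 1 ∧ Valued.v (((ϖ ^ d₀)⁻¹ * pairing σ ((StdForm.antidiagonal 3).over K) (((κ : GL (Fin 3) K) : Matrix (Fin 3) (Fin 3) K) *ᵥ Pi.single 0 1) (((((u⁻¹ * γ * u : unitaryGroupOfForm σ ((StdForm.antidiagonal 3).over K)) : GL (Fin 3) K) : Matrix (Fin 3) (Fin 3) K) - 1) *ᵥ (((κ : GL (Fin 3) K) : Matrix (Fin 3) (Fin 3) K) *ᵥ Pi.single 0 1))) - (-c₁) * a ^ 2) < 1)} ∧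
        {c : {M : Submodule 𝒪[K] (Fin 3 → K) // IsVertex σ ϖ ((StdForm.antidiagonal 3).over K) M} | (latticeGraph σ ϖ ((StdForm.antidiagonal 3).over K)).Adj v c ∧ (latticeGraph σ ϖ ((StdForm.antidiagonal 3).over K)).dist ⟨stdLattice K 3, 0, isSelfDualLattice_stdLattice_three_of_v hϖ⟩ c = (latticeGraph σ ϖ ((StdForm.antidiagonal 3).over K)).dist ⟨stdLattice K 3, 0, isSelfDualLattice_stdLattice_three_of_v hϖ⟩ v + 1 ∧ ∃ κ : unitaryGroupOfForm σ ((StdForm.antidiagonal 3).over K), κ ∈ unitaryInt σ ((StdForm.antidiagonal 3).over K) ∧ c = latticeGraphIso σ ϖ ((StdForm.antidiagonal 3).over K) (u * κ) ⟨latt (Matrix.diagonal ![(1 : K), 1, ϖ]), 2, isVertexLattice_two_N₁_of_neg hσϖ hϖ⟩ ∧ (¬ (Valued.v (pairing σ ((StdForm.antidiagonal 3).over K) ((((u * κ : unitaryGroupOfForm σ ((StdForm.antidiagonal 3).over K)) : GL (Fin 3) K) : Matrix (Fin 3) (Fin 3) K) *ᵥ Pi.single 0 1) ((A : Matrix (Fin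 3) (Fin 3) K) *ᵥ Pi.single i₀ 1)) < 1 ∧ Valued.v (pairing σ ((StdForm.antidiagonal 3).over K) ((((u * κ : unitaryGroupOfForm σ ((StdForm.antidiagonal 3).over K)) : GL (Fin 3) K) : Matrix (Fin 3) (Fin 3) K) *ᵥ Pi.single 0 1) (ϖ ^ s' • ((A : Matrix (Fin 3) (Fin 3) K) *ᵥ Pi.single k 1))) < 1) ∧ ∃ a : K, Valued.v a = 1 ∧ Valued.v (((ϖ ^ d₀)⁻¹ * pairing σ ((StdForm.antidiagonal 3).over K) (((κ : GL (Fin 3) K) : Matrix (Fin 3) (Fin 3) K) *ᵥ Pi.single 0 1) (((((u⁻¹ * γ * u : unitaryGroupOfForm σ ((StdForm.antidiagonal 3).over K)) : GL (Fin 3) K) : Matrix (Fin 3) (Fin 3) K) - 1) *ᵥ (((κ : GL (Fin 3) K) : Matrix (Fin 3) (Fin 3) K) *ᵥ Pi.single 0 1))) - (-(c₁ * ε)) * a ^ 2) < 1)} = {c : {M : Submodule 𝒪[K] (Fin 3 → K) // IsVertex σ ϖ ((StdForm.antidiagonal 3).over K) M} | (latticeGraph σ ϖ ((StdForm.antidiagonal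 3).over K)).Adj v c ∧ ∃ κ : unitaryGroupOfForm σ ((StdForm.antidiagonal 3).over K), κ ∈ unitaryInt σ ((StdForm.antidiagonal 3).over K) ∧ c = latticeGraphIso σ ϖ ((StdForm.antidiagonal 3).over K) (u * κ) ⟨latt (Matrix.diagonal ![(1 : K), 1, ϖ]), 2, isVertexLattice_two_N₁_of_neg hσϖ hϖ⟩ ∧ (∃ a : K, Valued.v a = 1 ∧ Valued.v (((ϖ ^ d₀)⁻¹ * pairing σ ((StdForm.antidiagonal 3).over K) (((κ : GL (Fin 3) K) : Matrix (Fin 3) (Fin 3) K) *ᵥ Pi.single 0 1) (((((u⁻¹ * γ * u : unitaryGroupOfForm σ ((StdForm.antidiagonal 3).over K)) : GL (Fin 3) K) : Matrix (Fin 3) (Fin 3) K) - 1) *ᵥ (((κ : GL (Fin 3) K) : Matrix (Fin 3) (Fin 3) K) *ᵥ Pi.single 0 1))) - (-(c₁ * ε)) * a ^ 2) < 1)}) := by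
    intro v hv hne
    obtain ⟨hfix, hSD, hlev⟩ := hmem v hv
    by_cases hvr : v = ⟨stdLattice K 3, 0, isSelfDualLattice_stdLattice_three_of_v hϖ⟩
    · obtain ⟨κ₁, hκ₁, hreg⟩ := exists_regDir_root_child_of_hyperbolic hσ hvσ hσϖ hϖ hres h2 hd A hA hA' hdA i₀ hs' hj hk hjk hhyp
      obtain ⟨u, hru, hlam, hmu⟩ := exists_adaptedFrame_root_of_regDir hσ hvσ hϖ A i₀ s' k hκ₁ hreg
      have hvu : v = latticeGraphIso σ ϖ ((StdForm.antidiagonal 3).over K) u ⟨stdLattice K 3, 0, isSelfDualLattice_stdLattice_three_of_v hϖ⟩ := hvr.trans hru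
      exact ⟨u, hvu, hlam, hmu, HyperbolicJunction.outwardSets_eq_of_adapted_root hσ hvσ hσϖ hϖ hd A hdA s hγA i₀ he hiso hgap hk c₁ ε hc₁ hεv u hvu hvr hSD hlev⟩
    · obtain ⟨u, hvu, hin, hdin, hlam, hmu⟩ := exists_adaptedFrame_of_mem_region hσ hvσ hσϖ hϖ hres h2 hnorm hT hγ0 d hd A hA hA' hdA s hγA i₀ he hiso hgap hk hSD hvr hfix hlev
      exact ⟨u, hvu, hlam, hmu, HyperbolicJunction.outwardSets_eq_of_adapted hσ hvσ hσϖ hϖ hT hd A hdA s hγA i₀ he hiso hgap hk c₁ ε hc₁ hεv u hvu hSD hvr hlev hin hdin hlam hmu⟩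
  have hframe_end : ∀ v ∈ sR, ¬ ϖ ^ (s' - 1) • ((A : Matrix (Fin 3) (Fin 3) K) *ᵥ Pi.single k 1) ∈ v.1 → ∃ u : unitaryGroupOfForm σ ((StdForm.antidiagonal 3).over K), v = latticeGraphIso σ ϖ ((StdForm.antidiagonal 3).over K) u ⟨stdLattice K 3, 0, isSelfDualLattice_stdLattice_three_of_v hϖ⟩ ∧ Valued.v (pairing σ ((StdForm.antidiagonal 3).over K) ((A : Matrix (Fin 3) (Fin 3) K) *ᵥ Pi.single i₀ 1) (((u : GL (Fin 3) K) : Matrix (Fin 3) (Fin 3) K) *ᵥ Pi.single 0 1)) < 1 ∧ Valued.v (pairing σ ((StdForm.antidiagonal 3).over K) (ϖ ^ s' • ((A : Matrix (Fin 3) (Fin 3) K) *ᵥ Pi.single k 1)) (((u : GL (Fin 3) K) : Matrix (Fin 3) (Fin 3) K) *ᵥ Pi.single 0 1)) < 1 ∧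
      ({c : {M : Submodule 𝒪[K] (Fin 3 → K) // IsVertex σ ϖ ((StdForm.antidiagonal 3).over K) M} | (latticeGraph σ ϖ ((StdForm.antidiagonal 3).over K)).Adj v c ∧ (latticeGraph σ ϖ ((StdForm.antidiagonal 3).over K)).dist ⟨stdLattice K 3, 0, isSelfDualLattice_stdLattice_three_of_v hϖ⟩ c = (latticeGraph σ ϖ ((StdForm.antidiagonal 3).over K)).dist ⟨stdLattice K 3, 0, isSelfDualLattice_stdLattice_three_of_v hϖ⟩ v + 1 ∧ ∃ κ : unitaryGroupOfForm σ ((StdForm.antidiagonal 3).over K), κ ∈ unitaryInt σ ((StdForm.antidiagonal 3).over K) ∧ c = latticeGraphIso σ ϖ ((StdForm.antidiagonal 3).over K) (u * κ) ⟨latt (Matrix.diagonal ![(1 : K), 1, ϖ]), 2, isVertexLattice_two_N₁_of_neg hσϖ hϖ⟩ ∧ (¬ (Valued.v (pairing σ ((StdForm.antidiagonal 3).over K) ((((u * κ : unitaryGroupOfForm σ ((StdForm.antidiagonal 3).over K)) : GL (Fin 3) K) : Matrix (Fin 3) (Fin 3) K) *ᵥ Pi.single 0 1) ((A : Matrix (Fin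 3) (Fin 3) K) *ᵥ Pi.single i₀ 1)) < 1 ∧ Valued.v (pairing σ ((StdForm.antidiagonal 3).over K) ((((u * κ : unitaryGroupOfForm σ ((StdForm.antidiagonal 3).over K)) : GL (Fin 3) K) : Matrix (Fin 3) (Fin 3) K) *ᵥ Pi.single 0 1) (ϖ ^ s' • ((A : Matrix (Fin 3) (Fin 3) K) *ᵥ Pi.single k 1))) < 1) ∧ Valued.v ((ϖ ^ d₀)⁻¹ * pairing σ ((StdForm.antidiagonal 3).over K) (((κ : GL (Fin 3) K) : Matrix (Fin 3) (Fin 3) K) *ᵥ Pi.single 0 1) (((((u⁻¹ * γ * u : unitaryGroupOfForm σ ((StdForm.antidiagonal 3).over K)) : GL (Fin 3) K) : Matrix (Fin 3) (Fin 3) K) - 1) *ᵥ (((κ : GL (Fin 3) K) : Matrix (Fin 3) (Fin 3) K) *ᵥ Pi.single 0 1))) < 1)} = {c : {M : Submodule 𝒪[K] (Fin 3 → K) // IsVertex σ ϖ ((StdForm.antidiagonal 3).over K) M} | (latticeGraph σ ϖ ((StdForm.antidiagonal 3).over K)).Adj v c ∧ ∃ κ : unitaryGroupOfForm σ ((StdForm.antidiagonal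 3).over K), κ ∈ unitaryInt σ ((StdForm.antidiagonal 3).over K) ∧ c = latticeGraphIso σ ϖ ((StdForm.antidiagonal 3).over K) (u * κ) ⟨latt (Matrix.diagonal ![(1 : K), 1, ϖ]), 2, isVertexLattice_two_N₁_of_neg hσϖ hϖ⟩ ∧ Valued.v ((ϖ ^ d₀)⁻¹ * pairing σ ((StdForm.antidiagonal 3).over K) (((κ : GL (Fin 3) K) : Matrix (Fin 3) (Fin 3) K) *ᵥ Pi.single 0 1) (((((u⁻¹ * γ * u : unitaryGroupOfForm σ ((StdForm.antidiagonal 3).over K)) : GL (Fin 3) K) : Matrix (Fin 3) (Fin 3) K) - 1) *ᵥ (((κ : GL (Fin 3) K) : Matrix (Fin 3) (Fin 3) K) *ᵥ Pi.single 0 1))) < 1} \ {c : {M : Submodule 𝒪[K] (Fin 3 → K) // IsVertex σ ϖ ((StdForm.antidiagonal 3).over K) M} | (latticeGraph σ ϖ ((StdForm.antidiagonal 3).over K)).Adj v c ∧ ∃ κ : unitaryGroupOfForm σ ((StdForm.antidiagonal 3).over K), κ ∈ unitaryInt σ ((StdForm.antidiagonal 3).over K) ∧ c = latticeGraphIso σ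 ϖ ((StdForm.antidiagonal 3).over K) (u * κ) ⟨latt (Matrix.diagonal ![(1 : K), 1, ϖ]), 2, isVertexLattice_two_N₁_of_neg hσϖ hϖ⟩ ∧ (Valued.v (pairing σ ((StdForm.antidiagonal 3).over K) ((((u * κ : unitaryGroupOfForm σ ((StdForm.antidiagonal 3).over K)) : GL (Fin 3) K) : Matrix (Fin 3) (Fin 3) K) *ᵥ Pi.single 0 1) ((A : Matrix (Fin 3) (Fin 3) K) *ᵥ Pi.single i₀ 1)) < 1 ∧ Valued.v (pairing σ ((StdForm.antidiagonal 3).over K) ((((u * κ : unitaryGroupOfForm σ ((StdForm.antidiagonal 3).over K)) : GL (Fin 3) K) : Matrix (Fin 3) (Fin 3) K) *ᵥ Pi.single 0 1) (ϖ ^ s' • ((A : Matrix (Fin 3) (Fin 3) K) *ᵥ Pi.single k 1))) < 1)} ∧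
        {c : {M : Submodule 𝒪[K] (Fin 3 → K) // IsVertex σ ϖ ((StdForm.antidiagonal 3).over K) M} | (latticeGraph σ ϖ ((StdForm.antidiagonal 3).over K)).Adj v c ∧ ∃ κ : unitaryGroupOfForm σ ((StdForm.antidiagonal 3).over K), κ ∈ unitaryInt σ ((StdForm.antidiagonal 3).over K) ∧ c = latticeGraphIso σ ϖ ((StdForm.antidiagonal 3).over K) (u * κ) ⟨latt (Matrix.diagonal ![(1 : K), 1, ϖ]), 2, isVertexLattice_two_N₁_of_neg hσϖ hϖ⟩ ∧ (Valued.v (pairing σ ((StdForm.antidiagonal 3).over K) ((((u * κ : unitaryGroupOfForm σ ((StdForm.antidiagonal 3).over K)) : GL (Fin 3) K) : Matrix (Fin 3) (Fin 3) K) *ᵥ Pi.single 0 1) ((A : Matrix (Fin 3) (Fin 3) K) *ᵥ Pi.single i₀ 1)) < 1 ∧ Valued.v (pairing σ ((StdForm.antidiagonal 3).over K) ((((u * κ : unitaryGroupOfForm σ ((StdForm.antidiagonal 3).over K)) : GL (Fin 3) K) : Matrix (Fin 3) (Fin 3) K) *ᵥ Pi.single 0 1) (ϖ ^ s' • ((A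 : Matrix (Fin 3) (Fin 3) K) *ᵥ Pi.single k 1))) < 1)} ⊆ {c : {M : Submodule 𝒪[K] (Fin 3 → K) // IsVertex σ ϖ ((StdForm.antidiagonal 3).over K) M} | (latticeGraph σ ϖ ((StdForm.antidiagonal 3).over K)).Adj v c ∧ ∃ κ : unitaryGroupOfForm σ ((StdForm.antidiagonal 3).over K), κ ∈ unitaryInt σ ((StdForm.antidiagonal 3).over K) ∧ c = latticeGraphIso σ ϖ ((StdForm.antidiagonal 3).over K) (u * κ) ⟨latt (Matrix.diagonal ![(1 : K), 1, ϖ]), 2, isVertexLattice_two_N₁_of_neg hσϖ hϖ⟩ ∧ Valued.v ((ϖ ^ d₀)⁻¹ * pairing σ ((StdForm.antidiagonal 3).over K) (((κ : GL (Fin 3) K) : Matrix (Fin 3) (Fin 3) K) *ᵥ Pi.single 0 1) (((((u⁻¹ * γ * u : unitaryGroupOfForm σ ((StdForm.antidiagonal 3).over K)) : GL (Fin 3) K) : Matrix (Fin 3) (Fin 3) K) - 1) *ᵥ (((κ : GL (Fin 3) K) : Matrix (Fin 3) (Fin 3) K) *ᵥ Pi.single 0 1))) < 1} ∧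
        {c : {M : Submodule 𝒪[K] (Fin 3 → K) // IsVertex σ ϖ ((StdForm.antidiagonal 3).over K) M} | (latticeGraph σ ϖ ((StdForm.antidiagonal 3).over K)).Adj v c ∧ (latticeGraph σ ϖ ((StdForm.antidiagonal 3).over K)).dist ⟨stdLattice K 3, 0, isSelfDualLattice_stdLattice_three_of_v hϖ⟩ c = (latticeGraph σ ϖ ((StdForm.antidiagonal 3).over K)).dist ⟨stdLattice K 3, 0, isSelfDualLattice_stdLattice_three_of_v hϖ⟩ v + 1 ∧ ∃ κ : unitaryGroupOfForm σ ((StdForm.antidiagonal 3).over K), κ ∈ unitaryInt σ ((StdForm.antidiagonal 3).over K) ∧ c = latticeGraphIso σ ϖ ((StdForm.antidiagonal 3).over K) (u * κ) ⟨latt (Matrix.diagonal ![(1 : K), 1, ϖ]), 2, isVertexLattice_two_N₁_of_neg hσϖ hϖ⟩ ∧ (¬ (Valued.v (pairing σ ((StdForm.antidiagonal 3).over K) ((((u * κ : unitaryGroupOfForm σ ((StdForm.antidiagonal 3).over K)) : GL (Fin 3) K) : Matrix (Fin 3) (Fin 3) K) *ᵥ Pi.single 0 1) ((A : Matrix (Fin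 3) (Fin 3) K) *ᵥ Pi.single i₀ 1)) < 1 ∧ Valued.v (pairing σ ((StdForm.antidiagonal 3).over K) ((((u * κ : unitaryGroupOfForm σ ((StdForm.antidiagonal 3).over K)) : GL (Fin 3) K) : Matrix (Fin 3) (Fin 3) K) *ᵥ Pi.single 0 1) (ϖ ^ s' • ((A : Matrix (Fin 3) (Fin 3) K) *ᵥ Pi.single k 1))) < 1) ∧ ∃ a : K, Valued.v a = 1 ∧ Valued.v (((ϖ ^ d₀)⁻¹ * pairing σ ((StdForm.antidiagonal 3).over K) (((κ : GL (Fin 3) K) : Matrix (Fin 3) (Fin 3) K) *ᵥ Pi.single 0 1) (((((u⁻¹ * γ * u : unitaryGroupOfForm σ ((StdForm.antidiagonal 3).over K)) : GL (Fin 3) K) : Matrix (Fin 3) (Fin 3) K) - 1) *ᵥ (((κ : GL (Fin 3) K) : Matrix (Fin 3) (Fin 3) K) *ᵥ Pi.single 0 1))) - (-c₁) * a ^ 2) < 1)} = {c : {M : Submodule 𝒪[K] (Fin 3 → K) // IsVertex σ ϖ ((StdForm.antidiagonal 3).over K) M} | (latticeGraph σ ϖ ((StdForm.antidiagonal 3).over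 K)).Adj v c ∧ ∃ κ : unitaryGroupOfForm σ ((StdForm.antidiagonal 3).over K), κ ∈ unitaryInt σ ((StdForm.antidiagonal 3).over K) ∧ c = latticeGraphIso σ ϖ ((StdForm.antidiagonal 3).over K) (u * κ) ⟨latt (Matrix.diagonal ![(1 : K), 1, ϖ]), 2, isVertexLattice_two_N₁_of_neg hσϖ hϖ⟩ ∧ (∃ a : K, Valued.v a = 1 ∧ Valued.v (((ϖ ^ d₀)⁻¹ * pairing σ ((StdForm.antidiagonal 3).over K) (((κ : GL (Fin 3) K) : Matrix (Fin 3) (Fin 3) K) *ᵥ Pi.single 0 1) (((((u⁻¹ * γ * u : unitaryGroupOfForm σ ((StdForm.antidiagonal 3).over K)) : GL (Fin 3) K) : Matrix (Fin 3) (Fin 3) K) - 1) *ᵥ (((κ : GL (Fin 3) K) : Matrix (Fin 3) (Fin 3) K) *ᵥ Pi.single 0 1))) - (-c₁) * a ^ 2) < 1)} ∧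
        {c : {M : Submodule 𝒪[K] (Fin 3 → K) // IsVertex σ ϖ ((StdForm.antidiagonal 3).over K) M} | (latticeGraph σ ϖ ((StdForm.antidiagonal 3).over K)).Adj v c ∧ (latticeGraph σ ϖ ((StdForm.antidiagonal 3).over K)).dist ⟨stdLattice K 3, 0, isSelfDualLattice_stdLattice_three_of_v hϖ⟩ c = (latticeGraph σ ϖ ((StdForm.antidiagonal 3).over K)).dist ⟨stdLattice K 3, 0, isSelfDualLattice_stdLattice_three_of_v hϖ⟩ v + 1 ∧ ∃ κ : unitaryGroupOfForm σ ((StdForm.antidiagonal 3).over K), κ ∈ unitaryInt σ ((StdForm.antidiagonal 3).over K) ∧ c = latticeGraphIso σ ϖ ((StdForm.antidiagonal 3).over K) (u * κ) ⟨latt (Matrix.diagonal ![(1 : K), 1, ϖ]), 2, isVertexLattice_two_N₁_of_neg hσϖ hϖ⟩ ∧ (¬ (Valued.v (pairing σ ((StdForm.antidiagonal 3).over K) ((((u * κ : unitaryGroupOfForm σ ((StdForm.antidiagonal 3).over K)) : GL (Fin 3) K) : Matrix (Fin 3) (Fin 3) K) *ᵥ Pi.single 0 1) ((A : Matrix (Fin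 3) (Fin 3) K) *ᵥ Pi.single i₀ 1)) < 1 ∧ Valued.v (pairing σ ((StdForm.antidiagonal 3).over K) ((((u * κ : unitaryGroupOfForm σ ((StdForm.antidiagonal 3).over K)) : GL (Fin 3) K) : Matrix (Fin 3) (Fin 3) K) *ᵥ Pi.single 0 1) (ϖ ^ s' • ((A : Matrix (Fin 3) (Fin 3) K) *ᵥ Pi.single k 1))) < 1) ∧ ∃ a : K, Valued.v a = 1 ∧ Valued.v (((ϖ ^ d₀)⁻¹ * pairing σ ((StdForm.antidiagonal 3).over K) (((κ : GL (Fin 3) K) : Matrix (Fin 3) (Fin 3) K) *ᵥ Pi.single 0 1) (((((u⁻¹ * γ * u : unitaryGroupOfForm σ ((StdForm.antidiagonal 3).over K)) : GL (Fin 3) K) : Matrix (Fin 3) (Fin 3) K) - 1) *ᵥ (((κ : GL (Fin 3) K) : Matrix (Fin 3) (Fin 3) K) *ᵥ Pi.single 0 1))) - (-(c₁ * ε)) * a ^ 2) < 1)} = {c : {M : Submodule 𝒪[K] (Fin 3 → K) // IsVertex σ ϖ ((StdForm.antidiagonal 3).over K) M} | (latticeGraph σ ϖ ((StdForm.antidiagonal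 3).over K)).Adj v c ∧ ∃ κ : unitaryGroupOfForm σ ((StdForm.antidiagonal 3).over K), κ ∈ unitaryInt σ ((StdForm.antidiagonal 3).over K) ∧ c = latticeGraphIso σ ϖ ((StdForm.antidiagonal 3).over K) (u * κ) ⟨latt (Matrix.diagonal ![(1 : K), 1, ϖ]), 2, isVertexLattice_two_N₁_of_neg hσϖ hϖ⟩ ∧ (∃ a : K, Valued.v a = 1 ∧ Valued.v (((ϖ ^ d₀)⁻¹ * pairing σ ((StdForm.antidiagonal 3).over K) (((κ : GL (Fin 3) K) : Matrix (Fin 3) (Fin 3) K) *ᵥ Pi.single 0 1) (((((u⁻¹ * γ * u : unitaryGroupOfForm σ ((StdForm.antidiagonal 3).over K)) : GL (Fin 3) K) : Matrix (Fin 3) (Fin 3) K) - 1) *ᵥ (((κ : GL (Fin 3) K) : Matrix (Fin 3) (Fin 3) K) *ᵥ Pi.single 0 1))) - (-(c₁ * ε)) * a ^ 2) < 1)}) := by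
    intro v hv hend'
    obtain ⟨hfix, hSD, hlev⟩ := hmem v hv
    have hvr : v ≠ ⟨stdLattice K 3, 0, isSelfDualLattice_stdLattice_three_of_v hϖ⟩ := by
      intro h0
      apply hend'
      rw [h0]
      refine smul_mem_of_v_le_one _ (by rw [map_pow]; exact pow_le_one₀ zero_le (by rw [hϖ, ← WithZero.exp_zero]; exact WithZero.exp_le_exp.2 (by norm_num))) ?_
      show (A : Matrix (Fin 3) (Fin 3) K) *ᵥ Pi.single k 1 ∈ stdLattice K 3
      rw [mem_stdLattice]; intro i; rw [Matrix.mulVec_single_one]; exact hA i k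
    obtain ⟨u, hvu, hin, hdin, hlam, hmu⟩ := exists_adaptedFrame_of_mem_region hσ hvσ hσϖ hϖ hres h2 hnorm hT hγ0 d hd A hA hA' hdA s hγA i₀ he hiso hgap hk hSD hvr hfix hlev
    exact ⟨u, hvu, hlam, hmu, HyperbolicJunction.outwardSets_eq_of_adapted hσ hvσ hσϖ hϖ hT hd A hdA s hγA i₀ he hiso hgap hk c₁ ε hc₁ hεv u hvu hSD hvr hlev hin hdin hlam hmu⟩
  -- ### (V3)(iv): the size of the region and the number of END vertices (★ F0P3-p03 (g16) `isoceles_regionCard_of_dirCounts`, `hdir` by ★ (V3′))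
  obtain ⟨hcard, hend⟩ := isoceles_regionCard_of_dirCounts hσ hvσ hσϖ hϖ hres h2 hnorm hγ0 d hd hdσ A hA hA' hdA s hs1 hsv hsσ hγA i₀ hd3 he hiso hclose hreg q hq sR hsR
    s' hs' hgap hk (fun v hv hlt => by
      obtain ⟨hfix, hSD, hlev⟩ := hmem v hv
      have hne : ϖ ^ (s' - 1) • ((A : Matrix (Fin 3) (Fin 3) K) *ᵥ Pi.single k 1) ∈ v.1 := by
        by_contra h
        have h' := (hjend v hv).2 h
        omega
      obtain ⟨u, hvu, hlam, hmu, -⟩ := hframe v hv hne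
      exact ⟨u, hvu, ncard_regDir_eq_two_of_adapted hσ hvσ hσϖ hϖ hres h2 hd A hdA s hγA i₀ he hiso hs' hgap hk u hvu hSD hlev hlam hne⟩)
  -- ### the per-vertex VALUES (junction cores ∘ (V3′) ∘ (V4))
  refine ⟨hcard, sum_regionTokens_hyperbolic_pool sR (fun v : {M : Submodule 𝒪[K] (Fin 3 → K) // IsVertex σ ϖ ((StdForm.antidiagonal 3).over K) M} => (latticeGraph σ ϖ ((StdForm.antidiagonal 3).over K)).dist ⟨stdLattice K 3, 0, isSelfDualLattice_stdLattice_three_of_v hϖ⟩ v = 2 * s') q s' hq3 hs' hcard hend (∃ a : K, Valued.v a = 1 ∧ Valued.v (((ϖ ^ d₀)⁻¹ * (s i₀ - s j) * (d i₀ * (-(Matrix.diagonal d).det)⁻¹)) + c₁ * a ^ 2) < 1) (∃ t : K, Valued.v t = 1 ∧ Valued.v (t ^ 2 - ((-1) ^ (s' + 1) * ((ϖ ^ d₀)⁻¹ * (s i₀ - s j)) * ((ϖ ^ (d₀ + 2 * s'))⁻¹ * (s k - s j)) * (d i₀ * d k))) < 1)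
    (fun v : {M : Submodule 𝒪[K] (Fin 3 → K) // IsVertex σ ϖ ((StdForm.antidiagonal 3).over K) M} => ({w | w ∈ {w | ∃ c, ((latticeGraph σ ϖ ((StdForm.antidiagonal 3).over K)).Adj v c ∧ (latticeGraph σ ϖ ((StdForm.antidiagonal 3).over K)).dist ⟨stdLattice K 3, 0, isSelfDualLattice_stdLattice_three_of_v hϖ⟩ c = (latticeGraph σ ϖ ((StdForm.antidiagonal 3).over K)).dist ⟨stdLattice K 3, 0, isSelfDualLattice_stdLattice_three_of_v hϖ⟩ v + 1 ∧ latticeGraphIso σ ϖ ((StdForm.antidiagonal 3).over K) γ c = c) ∧ ((latticeGraph σ ϖ ((StdForm.antidiagonal 3).over K)).Adj c w ∧ (latticeGraph σ ϖ ((StdForm.antidiagonal 3).over K)).dist ⟨stdLattice K 3, 0, isSelfDualLattice_stdLattice_three_of_v hϖ⟩ w = (latticeGraph σ ϖ ((StdForm.antidiagonal 3).over K)).dist ⟨stdLattice K 3, 0, isSelfDualLattice_stdLattice_three_of_v hϖ⟩ c + 1 ∧ latticeGraphIso σ ϖ ((StdForm.antidiagonal 3).over K) γ w = w)} ∧ (¬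 w.1.map ((Matrix.toLin' (((γ : GL (Fin 3) K) : Matrix (Fin 3) (Fin 3) K) - 1)).restrictScalars 𝒪[K]) ≤ scaleLattice (ϖ ^ d₀) w.1 ∧ (w.1.map ((Matrix.toLin' (((γ : GL (Fin 3) K) : Matrix (Fin 3) (Fin 3) K) - 1)).restrictScalars 𝒪[K]) ≤ scaleLattice (ϖ ^ (d₀ - 1)) w.1 ∧ ¬ w.1.map ((Matrix.toLin' (((γ : GL (Fin 3) K) : Matrix (Fin 3) (Fin 3) K) - 1)).restrictScalars 𝒪[K]) ≤ scaleLattice (ϖ ^ d₀) w.1))}).ncard)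
    (fun v : {M : Submodule 𝒪[K] (Fin 3 → K) // IsVertex σ ϖ ((StdForm.antidiagonal 3).over K) M} => ({w | w ∈ {w | ∃ c, ((latticeGraph σ ϖ ((StdForm.antidiagonal 3).over K)).Adj v c ∧ (latticeGraph σ ϖ ((StdForm.antidiagonal 3).over K)).dist ⟨stdLattice K 3, 0, isSelfDualLattice_stdLattice_three_of_v hϖ⟩ c = (latticeGraph σ ϖ ((StdForm.antidiagonal 3).over K)).dist ⟨stdLattice K 3, 0, isSelfDualLattice_stdLattice_three_of_v hϖ⟩ v + 1 ∧ latticeGraphIso σ ϖ ((StdForm.antidiagonal 3).over K) γ c = c) ∧ ((latticeGraph σ ϖ ((StdForm.antidiagonal 3).over K)).Adj c w ∧ (latticeGraph σ ϖ ((StdForm.antidiagonal 3).over K)).dist ⟨stdLattice K 3, 0, isSelfDualLattice_stdLattice_three_of_v hϖ⟩ w = (latticeGraph σ ϖ ((StdForm.antidiagonal 3).over K)).dist ⟨stdLattice K 3, 0, isSelfDualLattice_stdLattice_three_of_v hϖ⟩ c + 1 ∧ latticeGraphIso σ ϖ ((StdForm.antidiagonal 3).over K) γ w = w)} ∧ (¬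 w.1.map ((Matrix.toLin' (((γ : GL (Fin 3) K) : Matrix (Fin 3) (Fin 3) K) - 1)).restrictScalars 𝒪[K]) ≤ scaleLattice (ϖ ^ d₀) w.1 ∧ (w.1.map ((Matrix.toLin' (((γ : GL (Fin 3) K) : Matrix (Fin 3) (Fin 3) K) - 1)).restrictScalars 𝒪[K]) ≤ scaleLattice (ϖ ^ (d₀ - 2)) w.1 ∧ ¬ w.1.map ((Matrix.toLin' (((γ : GL (Fin 3) K) : Matrix (Fin 3) (Fin 3) K) - 1)).restrictScalars 𝒪[K]) ≤ scaleLattice (ϖ ^ (d₀ - 1)) w.1) ∧ ∃ y ∈ w.1, ∃ a : K, Valued.v a = 1 ∧ Valued.v ((ϖ ^ (d₀ - 2))⁻¹ * pairing σ ((StdForm.antidiagonal 3).over K) y ((((γ : GL (Fin 3) K) : Matrix (Fin 3) (Fin 3) K) - 1) *ᵥ y) - (c₁) * a ^ 2) < 1)}).ncard)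
    (fun v : {M : Submodule 𝒪[K] (Fin 3 → K) // IsVertex σ ϖ ((StdForm.antidiagonal 3).over K) M} => ({w | w ∈ {w | ∃ c, ((latticeGraph σ ϖ ((StdForm.antidiagonal 3).over K)).Adj v c ∧ (latticeGraph σ ϖ ((StdForm.antidiagonal 3).over K)).dist ⟨stdLattice K 3, 0, isSelfDualLattice_stdLattice_three_of_v hϖ⟩ c = (latticeGraph σ ϖ ((StdForm.antidiagonal 3).over K)).dist ⟨stdLattice K 3, 0, isSelfDualLattice_stdLattice_three_of_v hϖ⟩ v + 1 ∧ latticeGraphIso σ ϖ ((StdForm.antidiagonal 3).over K) γ c = c) ∧ ((latticeGraph σ ϖ ((StdForm.antidiagonal 3).over K)).Adj c w ∧ (latticeGraph σ ϖ ((StdForm.antidiagonal 3).over K)).dist ⟨stdLattice K 3, 0, isSelfDualLattice_stdLattice_three_of_v hϖ⟩ w = (latticeGraph σ ϖ ((StdForm.antidiagonal 3).over K)).dist ⟨stdLattice K 3, 0, isSelfDualLattice_stdLattice_three_of_v hϖ⟩ c + 1 ∧ latticeGraphIso σ ϖ ((StdForm.antidiagonal 3).over K) γ w = w)} ∧ (¬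 w.1.map ((Matrix.toLin' (((γ : GL (Fin 3) K) : Matrix (Fin 3) (Fin 3) K) - 1)).restrictScalars 𝒪[K]) ≤ scaleLattice (ϖ ^ d₀) w.1 ∧ (w.1.map ((Matrix.toLin' (((γ : GL (Fin 3) K) : Matrix (Fin 3) (Fin 3) K) - 1)).restrictScalars 𝒪[K]) ≤ scaleLattice (ϖ ^ (d₀ - 2)) w.1 ∧ ¬ w.1.map ((Matrix.toLin' (((γ : GL (Fin 3) K) : Matrix (Fin 3) (Fin 3) K) - 1)).restrictScalars 𝒪[K]) ≤ scaleLattice (ϖ ^ (d₀ - 1)) w.1) ∧ ¬ (∃ y ∈ w.1, ∃ a : K, Valued.v a = 1 ∧ Valued.v ((ϖ ^ (d₀ - 2))⁻¹ * pairing σ ((StdForm.antidiagonal 3).over K) y ((((γ : GL (Fin 3) K) : Matrix (Fin 3) (Fin 3) K) - 1) *ᵥ y) - (c₁) * a ^ 2) < 1))}).ncard)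
    ?_ ?_ ?_ ?_ ?_ ?_⟩
  · intro v hv hnotend
    obtain ⟨hfix, hSD, hlev⟩ := hmem v hv
    have hne : ϖ ^ (s' - 1) • ((A : Matrix (Fin 3) (Fin 3) K) *ᵥ Pi.single k 1) ∈ v.1 := by by_contra h; exact hnotend ((hjend v hv).2 h)
    obtain ⟨u, hvu, hlam, hmu, hEeq, hRDsub, hPeq, hMeq⟩ := hframe v hv hne
    have hRD := ncard_regDir_eq_two_of_adapted hσ hvσ hσϖ hϖ hres h2 hd A hdA s hγA i₀ he hiso hs' hgap hk u hvu hSD hlev hlam hne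
    obtain ⟨hνE, hνP, hνM⟩ := HyperbolicJunction.lineCounts_of_not_end hσ hvσ hσϖ hϖ hres h2 d hd hdσ A hdA s hγA i₀ he hiso hs' hgap hj hk hjk c₁ ε hc₁ hεv hε q hq u hvu hSD hlev hlam hmu hne hEeq hRDsub hPeq hMeq hRD
    obtain ⟨hsE, -, -⟩ := TypeOneRamifiedJunction.offRegion_tokenSlices_of_lineCounts hσ hvσ hσϖ hϖ hres h2 hT hγ0 hnorm d hd hdσ A hA hA' hdA s hs1 hsv hsσ hγA i₀ hd3 he hiso hclose hgap hk c₁ ε hc₁ hεv hε u hvu hSD hfix hlev _ _ _ hνE hνP hνM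
    show ({w | w ∈ {w | ∃ c, ((latticeGraph σ ϖ ((StdForm.antidiagonal 3).over K)).Adj v c ∧ (latticeGraph σ ϖ ((StdForm.antidiagonal 3).over K)).dist ⟨stdLattice K 3, 0, isSelfDualLattice_stdLattice_three_of_v hϖ⟩ c = (latticeGraph σ ϖ ((StdForm.antidiagonal 3).over K)).dist ⟨stdLattice K 3, 0, isSelfDualLattice_stdLattice_three_of_v hϖ⟩ v + 1 ∧ latticeGraphIso σ ϖ ((StdForm.antidiagonal 3).over K) γ c = c) ∧ ((latticeGraph σ ϖ ((StdForm.antidiagonal 3).over K)).Adj c w ∧ (latticeGraph σ ϖ ((StdForm.antidiagonal 3).over K)).dist ⟨stdLattice K 3, 0, isSelfDualLattice_stdLattice_three_of_v hϖ⟩ w = (latticeGraph σ ϖ ((StdForm.antidiagonal 3).over K)).dist ⟨stdLattice K 3, 0, isSelfDualLattice_stdLattice_three_of_v hϖ⟩ c + 1 ∧ latticeGraphIso σ ϖ ((StdForm.antidiagonal 3).over K) γ w = w)} ∧ (¬ w.1.map ((Matrix.toLin' (((γ : GL (Fin 3) K) : Matrix (Fin 3) (Fin 3) K) - 1)).restrictScalars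 𝒪[K]) ≤ scaleLattice (ϖ ^ d₀) w.1 ∧ (w.1.map ((Matrix.toLin' (((γ : GL (Fin 3) K) : Matrix (Fin 3) (Fin 3) K) - 1)).restrictScalars 𝒪[K]) ≤ scaleLattice (ϖ ^ (d₀ - 1)) w.1 ∧ ¬ w.1.map ((Matrix.toLin' (((γ : GL (Fin 3) K) : Matrix (Fin 3) (Fin 3) K) - 1)).restrictScalars 𝒪[K]) ≤ scaleLattice (ϖ ^ d₀) w.1))}).ncard = 0
    rw [hsE, mul_zero]
  · intro v hv hnotend
    obtain ⟨hfix, hSD, hlev⟩ := hmem v hv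
    have hne : ϖ ^ (s' - 1) • ((A : Matrix (Fin 3) (Fin 3) K) *ᵥ Pi.single k 1) ∈ v.1 := by by_contra h; exact hnotend ((hjend v hv).2 h)
    obtain ⟨u, hvu, hlam, hmu, hEeq, hRDsub, hPeq, hMeq⟩ := hframe v hv hne
    have hRD := ncard_regDir_eq_two_of_adapted hσ hvσ hσϖ hϖ hres h2 hd A hdA s hγA i₀ he hiso hs' hgap hk u hvu hSD hlev hlam hne
    obtain ⟨hνE, hνP, hνM⟩ := HyperbolicJunction.lineCounts_of_not_end hσ hvσ hσϖ hϖ hres h2 d hd hdσ A hdA s hγA i₀ he hiso hs' hgap hj hk hjk c₁ ε hc₁ hεv hε q hq u hvu hSD hlev hlam hmu hne hEeq hRDsub hPeq hMeq hRD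
    obtain ⟨-, hsP, -⟩ := TypeOneRamifiedJunction.offRegion_tokenSlices_of_lineCounts hσ hvσ hσϖ hϖ hres h2 hT hγ0 hnorm d hd hdσ A hA hA' hdA s hs1 hsv hsσ hγA i₀ hd3 he hiso hclose hgap hk c₁ ε hc₁ hεv hε u hvu hSD hfix hlev _ _ _ hνE hνP hνM
    show ({w | w ∈ {w | ∃ c, ((latticeGraph σ ϖ ((StdForm.antidiagonal 3).over K)).Adj v c ∧ (latticeGraph σ ϖ ((StdForm.antidiagonal 3).over K)).dist ⟨stdLattice K 3, 0, isSelfDualLattice_stdLattice_three_of_v hϖ⟩ c = (latticeGraph σ ϖ ((StdForm.antidiagonal 3).over K)).dist ⟨stdLattice K 3, 0, isSelfDualLattice_stdLattice_three_of_v hϖ⟩ v + 1 ∧ latticeGraphIso σ ϖ ((StdForm.antidiagonal 3).over K) γ c = c) ∧ ((latticeGraph σ ϖ ((StdForm.antidiagonal 3).over K)).Adj c w ∧ (latticeGraph σ ϖ ((StdForm.antidiagonal 3).over K)).dist ⟨stdLattice K 3, 0, isSelfDualLattice_stdLattice_three_of_v hϖ⟩ w = (latticeGraph σ ϖ ((StdForm.antidiagonal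 3).over K)).dist ⟨stdLattice K 3, 0, isSelfDualLattice_stdLattice_three_of_v hϖ⟩ c + 1 ∧ latticeGraphIso σ ϖ ((StdForm.antidiagonal 3).over K) γ w = w)} ∧ (¬ w.1.map ((Matrix.toLin' (((γ : GL (Fin 3) K) : Matrix (Fin 3) (Fin 3) K) - 1)).restrictScalars 𝒪[K]) ≤ scaleLattice (ϖ ^ d₀) w.1 ∧ (w.1.map ((Matrix.toLin' (((γ : GL (Fin 3) K) : Matrix (Fin 3) (Fin 3) K) - 1)).restrictScalars 𝒪[K]) ≤ scaleLattice (ϖ ^ (d₀ - 2)) w.1 ∧ ¬ w.1.map ((Matrix.toLin' (((γ : GL (Fin 3) K) : Matrix (Fin 3) (Fin 3) K) - 1)).restrictScalars 𝒪[K]) ≤ scaleLattice (ϖ ^ (d₀ - 1)) w.1) ∧ ∃ y ∈ w.1, ∃ a : K, Valued.v a = 1 ∧ Valued.v ((ϖ ^ (d₀ - 2))⁻¹ * pairing σ ((StdForm.antidiagonal 3).over K) y ((((γ : GL (Fin 3) K) : Matrix (Fin 3) (Fin 3) K) - 1) *ᵥ y) - (c₁) * a ^ 2) < 1)}).ncard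 = q * (if (∃ a : K, Valued.v a = 1 ∧ Valued.v (((ϖ ^ d₀)⁻¹ * (s i₀ - s j) * (d i₀ * (-(Matrix.diagonal d).det)⁻¹)) + c₁ * a ^ 2) < 1) then q - 1 else 0)
    rw [hsP, hqk]
  · intro v hv hnotend
    obtain ⟨hfix, hSD, hlev⟩ := hmem v hv
    have hne : ϖ ^ (s' - 1) • ((A : Matrix (Fin 3) (Fin 3) K) *ᵥ Pi.single k 1) ∈ v.1 := by by_contra h; exact hnotend ((hjend v hv).2 h)
    obtain ⟨u, hvu, hlam, hmu, hEeq, hRDsub, hPeq, hMeq⟩ := hframe v hv hne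
    have hRD := ncard_regDir_eq_two_of_adapted hσ hvσ hσϖ hϖ hres h2 hd A hdA s hγA i₀ he hiso hs' hgap hk u hvu hSD hlev hlam hne
    obtain ⟨hνE, hνP, hνM⟩ := HyperbolicJunction.lineCounts_of_not_end hσ hvσ hσϖ hϖ hres h2 d hd hdσ A hdA s hγA i₀ he hiso hs' hgap hj hk hjk c₁ ε hc₁ hεv hε q hq u hvu hSD hlev hlam hmu hne hEeq hRDsub hPeq hMeq hRD
    obtain ⟨-, -, hsM⟩ := TypeOneRamifiedJunction.offRegion_tokenSlices_of_lineCounts hσ hvσ hσϖ hϖ hres h2 hT hγ0 hnorm d hd hdσ A hA hA' hdA s hs1 hsv hsσ hγA i₀ hd3 he hiso hclose hgap hk c₁ ε hc₁ hεv hε u hvu hSD hfix hlev _ _ _ hνE hνP hνM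
    show ({w | w ∈ {w | ∃ c, ((latticeGraph σ ϖ ((StdForm.antidiagonal 3).over K)).Adj v c ∧ (latticeGraph σ ϖ ((StdForm.antidiagonal 3).over K)).dist ⟨stdLattice K 3, 0, isSelfDualLattice_stdLattice_three_of_v hϖ⟩ c = (latticeGraph σ ϖ ((StdForm.antidiagonal 3).over K)).dist ⟨stdLattice K 3, 0, isSelfDualLattice_stdLattice_three_of_v hϖ⟩ v + 1 ∧ latticeGraphIso σ ϖ ((StdForm.antidiagonal 3).over K) γ c = c) ∧ ((latticeGraph σ ϖ ((StdForm.antidiagonal 3).over K)).Adj c w ∧ (latticeGraph σ ϖ ((StdForm.antidiagonal 3).over K)).dist ⟨stdLattice K 3, 0, isSelfDualLattice_stdLattice_three_of_v hϖ⟩ w = (latticeGraph σ ϖ ((StdForm.antidiagonal 3).over K)).dist ⟨stdLattice K 3, 0, isSelfDualLattice_stdLattice_three_of_v hϖ⟩ c + 1 ∧ latticeGraphIso σ ϖ ((StdForm.antidiagonal 3).over K) γ w = w)} ∧ (¬ w.1.map ((Matrix.toLin' (((γ : GL (Fin 3) K) : Matrix (Fin 3) (Fin 3) K) - 1)).restrictScalars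 𝒪[K]) ≤ scaleLattice (ϖ ^ d₀) w.1 ∧ (w.1.map ((Matrix.toLin' (((γ : GL (Fin 3) K) : Matrix (Fin 3) (Fin 3) K) - 1)).restrictScalars 𝒪[K]) ≤ scaleLattice (ϖ ^ (d₀ - 2)) w.1 ∧ ¬ w.1.map ((Matrix.toLin' (((γ : GL (Fin 3) K) : Matrix (Fin 3) (Fin 3) K) - 1)).restrictScalars 𝒪[K]) ≤ scaleLattice (ϖ ^ (d₀ - 1)) w.1) ∧ ¬ (∃ y ∈ w.1, ∃ a : K, Valued.v a = 1 ∧ Valued.v ((ϖ ^ (d₀ - 2))⁻¹ * pairing σ ((StdForm.antidiagonal 3).over K) y ((((γ : GL (Fin 3) K) : Matrix (Fin 3) (Fin 3) K) - 1) *ᵥ y) - (c₁) * a ^ 2) < 1))}).ncard = q * (if (∃ a : K, Valued.v a = 1 ∧ Valued.v (((ϖ ^ d₀)⁻¹ * (s i₀ - s j) * (d i₀ * (-(Matrix.diagonal d).det)⁻¹)) + c₁ * a ^ 2) < 1) then 0 else q - 1)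
    rw [hsM, hqk]
  · intro v hv hdist
    obtain ⟨hfix, hSD, hlev⟩ := hmem v hv
    have hend' : ¬ ϖ ^ (s' - 1) • ((A : Matrix (Fin 3) (Fin 3) K) *ᵥ Pi.single k 1) ∈ v.1 := (hjend v hv).1 hdist
    obtain ⟨u, hvu, hlam, hmu, hEeq, hRDsub, hPeq, hMeq⟩ := hframe_end v hv hend'
    have hRD := ncard_regDir_eq_one_of_adapted hσ hvσ hσϖ hϖ hres h2 hd A hdA s hγA i₀ he hiso hs' hgap hk u hvu hSD hlev hend'
    obtain ⟨hνE, hνP, hνM⟩ := HyperbolicJunction.lineCounts_of_end hσ hvσ hσϖ hϖ hres h2 d hd hdσ A hdA s hγA i₀ he hiso hs' hgap hj hk hjk c₁ ε hc₁ hεv hε q hq u hvu hSD hlev hlam hmu hend' hEeq hRDsub hPeq hMeq hRD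
    obtain ⟨hsE, -, -⟩ := TypeOneRamifiedJunction.offRegion_tokenSlices_of_lineCounts hσ hvσ hσϖ hϖ hres h2 hT hγ0 hnorm d hd hdσ A hA hA' hdA s hs1 hsv hsσ hγA i₀ hd3 he hiso hclose hgap hk c₁ ε hc₁ hεv hε u hvu hSD hfix hlev _ _ _ hνE rfl rfl
    show ({w | w ∈ {w | ∃ c, ((latticeGraph σ ϖ ((StdForm.antidiagonal 3).over K)).Adj v c ∧ (latticeGraph σ ϖ ((StdForm.antidiagonal 3).over K)).dist ⟨stdLattice K 3, 0, isSelfDualLattice_stdLattice_three_of_v hϖ⟩ c = (latticeGraph σ ϖ ((StdForm.antidiagonal 3).over K)).dist ⟨stdLattice K 3, 0, isSelfDualLattice_stdLattice_three_of_v hϖ⟩ v + 1 ∧ latticeGraphIso σ ϖ ((StdForm.antidiagonal 3).over K) γ c = c) ∧ ((latticeGraph σ ϖ ((StdForm.antidiagonal 3).over K)).Adj c w ∧ (latticeGraph σ ϖ ((StdForm.antidiagonal 3).over K)).dist ⟨stdLattice K 3, 0, isSelfDualLattice_stdLattice_three_of_v hϖ⟩ w = (latticeGraph σ ϖ ((StdForm.antidiagonal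 3).over K)).dist ⟨stdLattice K 3, 0, isSelfDualLattice_stdLattice_three_of_v hϖ⟩ c + 1 ∧ latticeGraphIso σ ϖ ((StdForm.antidiagonal 3).over K) γ w = w)} ∧ (¬ w.1.map ((Matrix.toLin' (((γ : GL (Fin 3) K) : Matrix (Fin 3) (Fin 3) K) - 1)).restrictScalars 𝒪[K]) ≤ scaleLattice (ϖ ^ d₀) w.1 ∧ (w.1.map ((Matrix.toLin' (((γ : GL (Fin 3) K) : Matrix (Fin 3) (Fin 3) K) - 1)).restrictScalars 𝒪[K]) ≤ scaleLattice (ϖ ^ (d₀ - 1)) w.1 ∧ ¬ w.1.map ((Matrix.toLin' (((γ : GL (Fin 3) K) : Matrix (Fin 3) (Fin 3) K) - 1)).restrictScalars 𝒪[K]) ≤ scaleLattice (ϖ ^ d₀) w.1))}).ncard = q * (if (∃ t : K, Valued.v t = 1 ∧ Valued.v (t ^ 2 - ((-1) ^ (s' + 1) * ((ϖ ^ d₀)⁻¹ * (s i₀ - s j)) * ((ϖ ^ (d₀ + 2 * s'))⁻¹ * (s k - s j)) * (d i₀ * d k))) < 1) then 2 else 0)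
    rw [hsE, hqk]
  · intro v hv hdist
    obtain ⟨hfix, hSD, hlev⟩ := hmem v hv
    have hend' : ¬ ϖ ^ (s' - 1) • ((A : Matrix (Fin 3) (Fin 3) K) *ᵥ Pi.single k 1) ∈ v.1 := (hjend v hv).1 hdist
    obtain ⟨u, hvu, hlam, hmu, hEeq, hRDsub, hPeq, hMeq⟩ := hframe_end v hv hend'
    have hRD := ncard_regDir_eq_one_of_adapted hσ hvσ hσϖ hϖ hres h2 hd A hdA s hγA i₀ he hiso hs' hgap hk u hvu hSD hlev hend'
    obtain ⟨hνE, hνP, hνM⟩ := HyperbolicJunction.lineCounts_of_end hσ hvσ hσϖ hϖ hres h2 d hd hdσ A hdA s hγA i₀ he hiso hs' hgap hj hk hjk c₁ ε hc₁ hεv hε q hq u hvu hSD hlev hlam hmu hend' hEeq hRDsub hPeq hMeq hRD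
    obtain ⟨-, hsP, -⟩ := TypeOneRamifiedJunction.offRegion_tokenSlices_of_lineCounts hσ hvσ hσϖ hϖ hres h2 hT hγ0 hnorm d hd hdσ A hA hA' hdA s hs1 hsv hsσ hγA i₀ hd3 he hiso hclose hgap hk c₁ ε hc₁ hεv hε u hvu hSD hfix hlev _ _ _ hνE rfl rfl
    show 2 * ({w | w ∈ {w | ∃ c, ((latticeGraph σ ϖ ((StdForm.antidiagonal 3).over K)).Adj v c ∧ (latticeGraph σ ϖ ((StdForm.antidiagonal 3).over K)).dist ⟨stdLattice K 3, 0, isSelfDualLattice_stdLattice_three_of_v hϖ⟩ c = (latticeGraph σ ϖ ((StdForm.antidiagonal 3).over K)).dist ⟨stdLattice K 3, 0, isSelfDualLattice_stdLattice_three_of_v hϖ⟩ v + 1 ∧ latticeGraphIso σ ϖ ((StdForm.antidiagonal 3).over K) γ c = c) ∧ ((latticeGraph σ ϖ ((StdForm.antidiagonal 3).over K)).Adj c w ∧ (latticeGraph σ ϖ ((StdForm.antidiagonal 3).over K)).dist ⟨stdLattice K 3, 0, isSelfDualLattice_stdLattice_three_of_v hϖ⟩ w = (latticeGraph σ ϖ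 ((StdForm.antidiagonal 3).over K)).dist ⟨stdLattice K 3, 0, isSelfDualLattice_stdLattice_three_of_v hϖ⟩ c + 1 ∧ latticeGraphIso σ ϖ ((StdForm.antidiagonal 3).over K) γ w = w)} ∧ (¬ w.1.map ((Matrix.toLin' (((γ : GL (Fin 3) K) : Matrix (Fin 3) (Fin 3) K) - 1)).restrictScalars 𝒪[K]) ≤ scaleLattice (ϖ ^ d₀) w.1 ∧ (w.1.map ((Matrix.toLin' (((γ : GL (Fin 3) K) : Matrix (Fin 3) (Fin 3) K) - 1)).restrictScalars 𝒪[K]) ≤ scaleLattice (ϖ ^ (d₀ - 2)) w.1 ∧ ¬ w.1.map ((Matrix.toLin' (((γ : GL (Fin 3) K) : Matrix (Fin 3) (Fin 3) K) - 1)).restrictScalars 𝒪[K]) ≤ scaleLattice (ϖ ^ (d₀ - 1)) w.1) ∧ ∃ y ∈ w.1, ∃ a : K, Valued.v a = 1 ∧ Valued.v ((ϖ ^ (d₀ - 2))⁻¹ * pairing σ ((StdForm.antidiagonal 3).over K) y ((((γ : GL (Fin 3) K) : Matrix (Fin 3) (Fin 3) K) - 1) *ᵥ y) - (c₁) * a ^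 2) < 1)}).ncard = q * (if (∃ a : K, Valued.v a = 1 ∧ Valued.v (((ϖ ^ d₀)⁻¹ * (s i₀ - s j) * (d i₀ * (-(Matrix.diagonal d).det)⁻¹)) + c₁ * a ^ 2) < 1) then (if (∃ t : K, Valued.v t = 1 ∧ Valued.v (t ^ 2 - ((-1) ^ (s' + 1) * ((ϖ ^ d₀)⁻¹ * (s i₀ - s j)) * ((ϖ ^ (d₀ + 2 * s'))⁻¹ * (s k - s j)) * (d i₀ * d k))) < 1) then q - 3 else q - 1) else (if (∃ t : K, Valued.v t = 1 ∧ Valued.v (t ^ 2 - ((-1) ^ (s' + 1) * ((ϖ ^ d₀)⁻¹ * (s i₀ - s j)) * ((ϖ ^ (d₀ + 2 * s'))⁻¹ * (s k - s j)) * (d i₀ * d k))) < 1) then q - 1 else q + 1))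
    rw [hsP, hqk, mul_left_comm, hνP]
  · intro v hv hdist
    obtain ⟨hfix, hSD, hlev⟩ := hmem v hv
    have hend' : ¬ ϖ ^ (s' - 1) • ((A : Matrix (Fin 3) (Fin 3) K) *ᵥ Pi.single k 1) ∈ v.1 := (hjend v hv).1 hdist
    obtain ⟨u, hvu, hlam, hmu, hEeq, hRDsub, hPeq, hMeq⟩ := hframe_end v hv hend'
    have hRD := ncard_regDir_eq_one_of_adapted hσ hvσ hσϖ hϖ hres h2 hd A hdA s hγA i₀ he hiso hs' hgap hk u hvu hSD hlev hend'
    obtain ⟨hνE, hνP, hνM⟩ := HyperbolicJunction.lineCounts_of_end hσ hvσ hσϖ hϖ hres h2 d hd hdσ A hdA s hγA i₀ he hiso hs' hgap hj hk hjk c₁ ε hc₁ hεv hε q hq u hvu hSD hlev hlam hmu hend' hEeq hRDsub hPeq hMeq hRD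
    obtain ⟨-, -, hsM⟩ := TypeOneRamifiedJunction.offRegion_tokenSlices_of_lineCounts hσ hvσ hσϖ hϖ hres h2 hT hγ0 hnorm d hd hdσ A hA hA' hdA s hs1 hsv hsσ hγA i₀ hd3 he hiso hclose hgap hk c₁ ε hc₁ hεv hε u hvu hSD hfix hlev _ _ _ hνE rfl rfl
    show 2 * ({w | w ∈ {w | ∃ c, ((latticeGraph σ ϖ ((StdForm.antidiagonal 3).over K)).Adj v c ∧ (latticeGraph σ ϖ ((StdForm.antidiagonal 3).over K)).dist ⟨stdLattice K 3, 0, isSelfDualLattice_stdLattice_three_of_v hϖ⟩ c = (latticeGraph σ ϖ ((StdForm.antidiagonal 3).over K)).dist ⟨stdLattice K 3, 0, isSelfDualLattice_stdLattice_three_of_v hϖ⟩ v + 1 ∧ latticeGraphIso σ ϖ ((StdForm.antidiagonal 3).over K) γ c = c) ∧ ((latticeGraph σ ϖ ((StdForm.antidiagonal 3).over K)).Adj c w ∧ (latticeGraph σ ϖ ((StdForm.antidiagonal 3).over K)).dist ⟨stdLattice K 3, 0, isSelfDualLattice_stdLattice_three_of_v hϖ⟩ w = (latticeGraph σ ϖ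 ((StdForm.antidiagonal 3).over K)).dist ⟨stdLattice K 3, 0, isSelfDualLattice_stdLattice_three_of_v hϖ⟩ c + 1 ∧ latticeGraphIso σ ϖ ((StdForm.antidiagonal 3).over K) γ w = w)} ∧ (¬ w.1.map ((Matrix.toLin' (((γ : GL (Fin 3) K) : Matrix (Fin 3) (Fin 3) K) - 1)).restrictScalars 𝒪[K]) ≤ scaleLattice (ϖ ^ d₀) w.1 ∧ (w.1.map ((Matrix.toLin' (((γ : GL (Fin 3) K) : Matrix (Fin 3) (Fin 3) K) - 1)).restrictScalars 𝒪[K]) ≤ scaleLattice (ϖ ^ (d₀ - 2)) w.1 ∧ ¬ w.1.map ((Matrix.toLin' (((γ : GL (Fin 3) K) : Matrix (Fin 3) (Fin 3) K) - 1)).restrictScalars 𝒪[K]) ≤ scaleLattice (ϖ ^ (d₀ - 1)) w.1) ∧ ¬ (∃ y ∈ w.1, ∃ a : K, Valued.v a = 1 ∧ Valued.v ((ϖ ^ (d₀ - 2))⁻¹ * pairing σ ((StdForm.antidiagonal 3).over K) y ((((γ : GL (Fin 3) K) : Matrix (Fin 3) (Fin 3) K) - 1) *ᵥ y) - (c₁)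 * a ^ 2) < 1))}).ncard = q * (if (∃ a : K, Valued.v a = 1 ∧ Valued.v (((ϖ ^ d₀)⁻¹ * (s i₀ - s j) * (d i₀ * (-(Matrix.diagonal d).det)⁻¹)) + c₁ * a ^ 2) < 1) then (if (∃ t : K, Valued.v t = 1 ∧ Valued.v (t ^ 2 - ((-1) ^ (s' + 1) * ((ϖ ^ d₀)⁻¹ * (s i₀ - s j)) * ((ϖ ^ (d₀ + 2 * s'))⁻¹ * (s k - s j)) * (d i₀ * d k))) < 1) then q - 1 else q + 1) else (if (∃ t : K, Valued.v t = 1 ∧ Valued.v (t ^ 2 - ((-1) ^ (s' + 1) * ((ϖ ^ d₀)⁻¹ * (s i₀ - s j)) * ((ϖ ^ (d₀ + 2 * s'))⁻¹ * (s k - s j)) * (d i₀ * d k))) < 1) then q - 3 else q - 1))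
    rw [hsM, hqk, mul_left_comm, hνM]

end Literature.NumberTheory.Rogawski1990

end
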